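import Mathlib
import HarnessLib
import HarnessLib.Audit
import Summits.AtomisticToContinuum.Statement
import Literature.MathematicalPhysics.QuantumLattice.HeisenbergModel
import Literature.Probability.LatticeModels.LatticeGraph
import Literature.MathematicalPhysics.QuantumManyBody.PeriodicBoseGas
import HarnessLib.Audit.Status.Attr

/-!
Route: BECZeroCrossingDilute

DORMANT since 2026-08-29T19:27:06Z (census g0: costume|duplicate of —; reader census-reader-34-g0) — unstaffed, not closed; items shared with open routes are served there. `ledger route dormant <id> --off` reactivates.

# Route BECZeroCrossingDilute — zero-crossing anchor, dilute corner — nearly isotropic easy-plane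
XXZ ferromagnet = dilute lattice Bose gas with a(Δ)→0 at an exactly condensed SU(2) point;
persistence + scheme transfer

Conforming successor (D-0027 §2.1) of the retired route BECZeroCrossingAnchor; spine and sole card
xxz-zero-crossing-anchor, taken in
its DILUTE CORNER. The spin-½ easy-plane ferromagnet H_Δ = −Σ_⟨xy⟩(S¹_xS¹_y + S²_xS²_y + Δ S³_xS³_y)
= `xxzHamiltonian 1 (torusGraph 3 L) (−1) Δ`
on (ℤ/Lℤ)³ is, by Matsubara–Matsuda, the hard-core lattice Bose gas (hopping ½, mass 1) with
nearest-neighbour attraction Δ; the sector of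
N bosons (S³_tot = N − L³/2) is selected by the penalty 4L³·(S³_tot + (L³/2 − N)·1)², and B_L(N,Δ)
:= Re ω(S¹_tot² + S²_tot²) + N − L³/2 =
⟨S⁺_tot S⁻_tot⟩ = L³·λ_max(γ_N) is L³ times the largest eigenvalue of the one-body density matrix of
the (Perron–Frobenius unique) sector
ground state. At Δ = 1 every sector ground state is the hard-core-projected condensate |S = L³/2, M⟩
and B_L(N,1) = N(L³ − N + 1) EXACTLY
(condensate fraction 1 − ν + 1/L³), while the two-magnon scattering length a(Δ) = (3/2π)(1 − Δ) +
O((1−Δ)²) crosses zero there (Dyson).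
It suffices to show X = X_IR ∧ X_tr ∧ X_bc: X_IR (NearIsotropicDiluteBEC) — there are ε, ν₀ > 0 such
that for ALL L ≥ 2, all N ≤ ν₀L³
and all Δ ∈ [1 − ε, 1], 2·B_L(N,Δ) ≥ N(L³ − N + 1): at least half of the exact SU(2) condensate
survives the bounded easy-plane deformation
(1 − Δ)·Σ S³S³ uniformly in the volume throughout the dilute corner (small parameter Y = ν·a(Δ)³; it
contains ν → 0 at fixed Δ < 1, the
lattice twin of the conjunct's ρ → 0 at fixed v); X_tr (SchemeTransfer) — X_IR implies torus BEC of
the dilute continuum gas (PeriodicBEC: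
constant-mode occupation ≥ cN for every δ-near-minimiser of the periodic N-body energy at side
(N/ρ)^{1/3}, all small ρ, every repulsive
finite-range v); X_bc (BoundaryTransferWeak, shared item stmt-AtomisticToContinuum-0827) — torus BEC
⇒ ∃ρ₀ ∀ρ < ρ₀ HasGroundStateBEC v ρ.
Lean: `(∃ ε ν₀ : ℝ, 0 < ε ∧ 0 < ν₀ ∧ ∀ (L : ℕ) [NeZero L], 2 ≤ L → ∀ N : ℕ, (N : ℝ) ≤ ν₀ * (L : ℝ) ^
3 → ∀ Δ : ℝ, 1 - ε ≤ Δ → Δ ≤ 1 → (N : ℝ) * ((L : ℝ) ^ 3 - N + 1) ≤ 2 *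
(((Literature.MathematicalPhysics.QuantumLattice.xxzHamiltonian 1
(Literature.Probability.LatticeModels.torusGraph 3 L) (-1) Δ + (((3 + 1) * L ^ 3 : ℕ) : ℂ) •
(Literature.MathematicalPhysics.QuantumLattice.totalSpin 1 2 + ((L : ℂ) ^ 3 / 2 - (N : ℂ)) • 1) ^
2).groundStateFunctional (Literature.MathematicalPhysics.QuantumLattice.totalSpin 1 0 *
Literature.MathematicalPhysics.QuantumLattice.totalSpin 1 0 +
Literature.MathematicalPhysics.QuantumLattice.totalSpin 1 1 *
Literature.MathematicalPhysics.QuantumLattice.totalSpin 1 1)).re + N - (L : ℝ) ^ 3 / 2)) ∧ ((∃ ε ν₀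
: ℝ, 0 < ε ∧ 0 < ν₀ ∧ ∀ (L : ℕ) [NeZero L], 2 ≤ L → ∀ N : ℕ, (N : ℝ) ≤ ν₀ * (L : ℝ) ^ 3 → ∀ Δ : ℝ, 1
- ε ≤ Δ → Δ ≤ 1 → (N : ℝ) * ((L : ℝ) ^ 3 - N + 1) ≤ 2 *
(((Literature.MathematicalPhysics.QuantumLattice.xxzHamiltonian 1
(Literature.Probability.LatticeModels.torusGraph 3 L) (-1) Δ + (((3 + 1) * L ^ 3 : ℕ) : ℂ) •
(Literature.MathematicalPhysics.QuantumLattice.totalSpin 1 2 + ((L : ℂ) ^ 3 / 2 - (N : ℂ)) • 1) ^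
2).groundStateFunctional (Literature.MathematicalPhysics.QuantumLattice.totalSpin 1 0 *
Literature.MathematicalPhysics.QuantumLattice.totalSpin 1 0 +
Literature.MathematicalPhysics.QuantumLattice.totalSpin 1 1 *
Literature.MathematicalPhysics.QuantumLattice.totalSpin 1 1)).re + N - (L : ℝ) ^ 3 / 2)) → ∀ v : ℝ →
ENNReal, Literature.MathematicalPhysics.QuantumManyBody.BoseGas.IsRepulsiveFiniteRange v → ∃ ρ₀ : ℝ,
0 < ρ₀ ∧ ∀ ρ : ℝ, 0 < ρ → ρ < ρ₀ → ∃ c : ℝ, 0 < c ∧ ∀ᶠ N : ℕ in Filter.atTop, ∃ δ : ENNReal, 0 < δ ∧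
∀ Ψ : Literature.MathematicalPhysics.QuantumManyBody.BoseGas.PeriodicTrialState N
(Literature.MathematicalPhysics.QuantumManyBody.BoseGas.sideLength ρ N),
Literature.MathematicalPhysics.QuantumManyBody.BoseGas.periodicEnergy v Ψ ≤
Literature.MathematicalPhysics.QuantumManyBody.BoseGas.periodicGroundStateEnergy v N
(Literature.MathematicalPhysics.QuantumManyBody.BoseGas.sideLength ρ N) + δ → ENNReal.ofReal (c * N)
≤ Literature.MathematicalPhysics.QuantumManyBody.BoseGas.condensateOccupation N
(Literature.MathematicalPhysics.QuantumManyBody.BoseGas.sideLength ρ N) Ψ.ψ) ∧ (∀ v : ℝ → ENNReal,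
Literature.MathematicalPhysics.QuantumManyBody.BoseGas.IsRepulsiveFiniteRange v → (∃ ρ₀ : ℝ, 0 < ρ₀
∧ ∀ ρ : ℝ, 0 < ρ → ρ < ρ₀ → ∃ c : ℝ, 0 < c ∧ ∀ᶠ N : ℕ in Filter.atTop, ∃ δ : ENNReal, 0 < δ ∧ ∀ Ψ :
Literature.MathematicalPhysics.QuantumManyBody.BoseGas.PeriodicTrialState N
(Literature.MathematicalPhysics.QuantumManyBody.BoseGas.sideLength ρ N),
Literature.MathematicalPhysics.QuantumManyBody.BoseGas.periodicEnergy v Ψ ≤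
Literature.MathematicalPhysics.QuantumManyBody.BoseGas.periodicGroundStateEnergy v N
(Literature.MathematicalPhysics.QuantumManyBody.BoseGas.sideLength ρ N) + δ → ENNReal.ofReal (c * N)
≤ Literature.MathematicalPhysics.QuantumManyBody.BoseGas.condensateOccupation N
(Literature.MathematicalPhysics.QuantumManyBody.BoseGas.sideLength ρ N) Ψ.ψ) → ∃ ρ₀ : ℝ, 0 < ρ₀ ∧ ∀
ρ : ℝ, 0 < ρ → ρ < ρ₀ → Literature.MathematicalPhysics.QuantumManyBody.BoseGas.HasGroundStateBEC v
ρ)`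

## Assembly
Pure logic, sorry-free in Sketch.lean and filed as glue.lean (the DECIDING theorem, D-0027 §2.1):
`theorem closes (hN : NearIsotropicDiluteBEC) (hT : SchemeTransfer) (hB : BoundaryTransferWeak) :
_root_.BoseEinsteinCondensation :=
fun v hv => hB v hv (hT hN v hv)` — the antecedent of SchemeTransfer is NearIsotropicDiluteBEC
verbatim, its consequent is the antecedent of
BoundaryTransferWeak verbatim, and the conjunct `_root_.BoseEinsteinCondensation` unfolds to `∀ v,
IsRepulsiveFiniteRange v → ∃ρ₀ > 0, ∀ρ ∈
(0,ρ₀), HasGroundStateBEC v ρ` (axioms: propext, Classical.choice, Quot.sound). The four supports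
are lemmas toward / calibrations of the
rank-2 crux (sector encoding, exact endpoint value, sign of a(Δ), comparison between the endpoints)
and are deliberately not hypotheses.

Rationale: WHY THIS LINE. The planar S = ½ ferromagnet near its isotropic point is the one interacting Bose gas
in d = 3 with an EXACTLY condensed endpoint at every
filling: at Δ = 1 SU(2) forces the sector ground state to be the hard-core-projected condensate
(Heims1964; Tasaki2020 §2.5; the value
N(L³−N+1) saturates Toth1991's bound), and Dyson1956's kinematical cancellation makes the two-magnon
scattering length vanish there, so the
dictionary of MatsubaraMatsuda1956 sends ρa³ to Y = ν·((3/2π)(1−Δ))³ → 0 at FIXED lattice filling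
with the lattice as ultraviolet regulator
and a BOUNDED, diagonal deformation V = Σ S³S³ (relative size 1 − Δ, explicit unperturbed magnon
eigenbasis; two-magnon problem solvable on
ℤ³, Wortis1963; thermal spin-wave validity at the isotropic point CorreggiGiulianiSeiringer2015).
Reflection positivity cannot enter the
interval (0,1] (ferromagnetic z-coupling has the wrong sign parity, Speer1985; KLS1988PRL is the Δ =
0, half-filling endpoint only), so the
rank-2 crux is the marginal d = 3, T = 0 infrared problem of Benfatto1994 / BFKT2017 (whose declared
target is symmetry breaking for
lattice bosons) in its least encumbered instance — no hard-core renormalisation, no large-field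
region from an unbounded field, smallness
available along a → 0 as well as ν → 0. Imported: constructive RG / Ward-identity resummation around
an exactly solvable gapless point
(mathematical QFT), Perron–Frobenius sector structure and finite-volume two-body scattering
(Luscher1986, HuangYang1957) for the supports.
What it does that prior routes do not: BECStronglyRayleigh and BECGroundStateSOS work the Δ = 0
(pure hard-core) lattice gas off half
filling by zero-freeness resp. SOS certificates; this line deforms from the OTHER exact end, where
the condensate is explicit in every sector,
and its lattice theorem is the literal twin (ν → 0 at fixed Δ < 1) of the conjunct's regime; the
continuum tail is the shared one
(bridge + stmt-0827), exactly as in those conforming lattice routes. Negatives index: empty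
footprint.

RANKED CRUXES. #2 NearIsotropicDiluteBEC (crux) — (card G3, dilute corner, d = 3) there are ε > 0
and ν₀ > 0 such that for every L ≥ 2, every particle number N ≤ ν₀L³ and every anisotropy Δ ∈ [1 −
ε, 1], the sector ground state of the easy-plane XXZ ferromagnet on (ℤ/Lℤ)³ keeps at least half of
the exact SU(2) condensate: N(L³ − N + 1) ≤ 2·B_L(N,Δ), B_L(N,Δ) = Re ω_pen(S¹_tot² + S²_tot²) + N −
L³/2 = ⟨S⁺_tot S⁻_tot⟩ = L³·λ_max(γ_N) (ω_pen = ground-state functional of H_Δ + 4L³(S³_tot + (L³/2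
− N))²). Uniform in L; contains the thermodynamic dilute limit ν → 0 at fixed Δ = 1 − ε (lattice
twin of the conjunct) and the zero-crossing limit Δ → 1 at fixed ν ≤ ν₀. [difficulty: open-problem]
(why it might fail: It IS the marginal d=3, T=0 infrared problem (BogoliubovPerturbationInfrared):
naive second order in (1−Δ) gives a depletion Σ_k k⁻⁴ ∼ L before resummation; no
continuous-symmetry-broken Bose ground state has been constructed uniformly in volume (Benfatto: n!
bounds; BFKT incomplete).) [Benfatto1994, BFKT2017, BalabanEtAl2010, CorreggiGiulianiSeiringer2015,
Dyson1956, Tasaki2020, LSSY2005,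
Literature.Barriers.AtomisticToContinuum.BogoliubovPerturbationInfrared]
#3 SchemeTransfer (crux) — (card G5, the bridge) NearIsotropicDiluteBEC (antecedent verbatim)
implies PeriodicBEC: for every repulsive finite-range radial v there is ρ₀ > 0 such that for 0 < ρ <
ρ₀, some c > 0, all large N and some δ > 0, every δ-near-minimiser of the periodic N-body energy on
the torus of side (N/ρ)^{1/3} has constant-mode occupation ≥ cN (body of
stmt-AtomisticToContinuum-0826, verbatim as consequent). Intended discharge: re-run the scheme that
proves the antecedent (bounded deformation of an exactly condensed gapless point, small parameter Y)
with Y = ρa³ after a Dyson-lemma softening of v; only the SCHEME transfers, not the anchor — no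
lattice-to-continuum limit theorem is claimed. [deps: NearIsotropicDiluteBEC] [difficulty:
open-problem] (why it might fail: Bare implication, no easier than PeriodicBEC unless the antecedent
is proved by a transferable scheme: the continuum has no SU(2)-exact endpoint at fixed admissible v
(a = 0 only for v = 0), hard cores make the deformation unbounded, and Dyson softening costs kinetic
energy.) [LSSY2005, Fournais2020, Benfatto1994, MatsubaraMatsuda1956,
Literature.Barriers.AtomisticToContinuum.BogoliubovPerturbationInfrared]
#4 BoundaryTransferWeak (crux) — (shared item stmt-AtomisticToContinuum-0827, verbatim) for each
repulsive finite-range v, PeriodicBEC(v) implies ∃ρ₀ > 0 ∀ρ ∈ (0, ρ₀) HasGroundStateBEC v ρ — the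
audited Dirichlet, mode-free form of the conjunct (λ_max(γ) ≥ cN via condensateNumber). Expected
proof: Neumann bracketing of interior sub-boxes (−Δ_Dir ≥ ⊕−Δ_Neu, v ≥ 0, v ≤ v^per) plus a
mode-free criterion; only the ENERGY analogue is in print. [deps: SchemeTransfer] [difficulty: L]
(why it might fail: PeriodicBEC(v) is ground-state-only at side (N/ρ)^{1/3}: the Dirichlet ground
state is a periodic trial state but lies a wall term ≫ δ above E₀^per, and interior restrictions are
neither periodic nor of sharp N; no condensate b.c. transfer is in print.) [LSSY2005, Junge2026,
BoccatoSeiringer2023, LauwersVerbeureZagrebnov2003, Fournais2020]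
#9 AnchorExact (support) — (card G1(i), the SU(2) end; provable now) for L ≥ 2 and every N ≤ L³:
B_L(N,1) = N(L³ − N + 1). Proof: H_1 + |E|/4 = ½Σ_⟨xy⟩(1 − T_xy) (T = transposition) on the
connected torus graph, so the sector ground space of the penalised Hamiltonian is the one symmetric
vector |S = L³/2, M = N − L³/2⟩, and ⟨S¹_tot² + S²_tot²⟩ + M = S(S+1) − M² + M = N(L³ − N + 1).
[difficulty: provable-now] [Tasaki2020, Toth1991, Heims1964]
#9 PenaltySelectsSectorXXZ (support) — (encoding lemma; XXZ version of
stmt-AtomisticToContinuum-5011; provable now) for L ≥ 1, N ≤ L³ and 0 ≤ Δ ≤ 1 every ground vector of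
H_Δ + 4L³·(S³_tot + (L³/2 − N)·1)² lies in the sector S³_tot = N − L³/2: H_Δ commutes with S³_tot,
each bond −(S¹S¹ + S²S² + ΔS³S³) has spectral width exactly 1 for |Δ| ≤ 1, so the width of H_Δ is ≤
|E| ≤ 3L³ < 4L³ ≤ the penalty of any other sector, and the target sector is non-empty. [difficulty:
provable-now] [Tasaki2020, KLS1988PRL]
#9 AnisotropyMonotone (support) — (card G2 in the repaired, SUMMED form; d = 3; the comparison line
between the two anchored endpoints, NOT an antecedent of `closes`) for L ≥ 2, every sector N ≤ L³
and 0 ≤ Δ ≤ Δ' ≤ 1: A_L(N,Δ) ≤ A_L(N,Δ'), A_L(N,Δ) = Re ω_pen(S¹_tot² + S²_tot²) — raising the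
ferromagnetic z-coupling (lowering the magnon scattering length) never lowers the planar moment of
the sector ground state; automatic at Δ' = 1 (A_L(N,1) is the maximum of S¹_tot²+S²_tot² on the
sector). With KLS (tree theorem kennedy_lieb_shastry_xy_ground_holds) and a sector-mixture lemma it
would give planar LRO at half filling for every Δ ∈ [0,1]; here it is the cheapest decisive test of
the dictionary. Filed as support so that its refutation is a `--drop`, never a broken assembly.
[difficulty: L] [BenassiLeesUeltschi2016, KLS1988PRL, Toth1991, Tasaki2020]
#9 ScatteringLengthSign (support) — (card G1(ii), the sign the dictionary rests on; d = 3) for every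
Δ ∈ [0,1) the two-magnon finite-volume energy shift is eventually bounded below at the
scattering-length scale: ∃ c > 0 ∃ L₀ ∀ L ≥ L₀, L³·(E_L(2) − 2E_L(1) + E_L(0)) ≥ c, E_L(k) = lowest
energy of H_Δ on (ℤ/Lℤ)³ in the sector S³_tot = k − L³/2 (Huang–Yang/Lüscher: the limit is 4π·a(Δ)
for magnon mass 1, ħ = 1, with a(Δ) the s-wave scattering length of hard core + nearest-neighbour
well Δ, positive below the bound-state threshold, and a(Δ) = (3/2π)(1−Δ) + O((1−Δ)²) because the
SU(2) zero-energy pair state is uniform off the diagonal; at Δ = 1 the shift vanishes identically).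
[difficulty: M] [Dyson1956, Wortis1963, HuangYang1957, Luscher1986, LSSY2005]

TWO-LAYER PLAN. Foreseen glued splits (none filed now; k ≤ 3, depth 1): NearIsotropicDiluteBEC ⇐
TwoBodyLadder (uniform control of the sector two-magnon
problem: a(Δ), no bound state, finite-volume shifts — the layer where ScatteringLengthSign lives) →
SectorBogoliubovPersistence (a (1−Δ)-uniform
lower bound on ⟨S⁺_totS⁻_tot⟩ from a resummed expansion around |S_max, M⟩ organised by the Ward
identity of the residual U(1), the bounded V
and the lattice UV; the genuinely open step) → NearIsotropicDiluteBEC; SchemeTransfer ⇐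
DysonSoftening (replace v by a bounded nearest-image
potential at a kinetic-energy price o(ρa) per particle, LSSY2005 Lemma 2.5-type) →
BoundedDeformationScheme (the continuum re-run with
Y = ρa³) → SchemeTransfer, filed only once the rank-2 crux has a proof whose scheme is visible;
BoundaryTransferWeak is shared and split, if at
all, by its home routes. Helper lemmas (bond spectral width, S⁺S⁻ = S² − (S³)² + S³,
Perron–Frobenius uniqueness of the sector ground state,
block decomposition of the penalised Hamiltonian) ride as `--supports`, never items.

KILL CRITERIA. NearIsotropicDiluteBEC refuted (some dilute sector sequence N_L ≤ ν₀L³ with 2B_L <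
N(L³−N+1) for Δ arbitrarily close to 1, i.e. the
condensate of the nearly isotropic dilute magnon gas is NOT uniformly macroscopic) closes the route
`refuted:NearIsotropicDiluteBEC` — the
dictionary itself would be wrong. A proof that a(Δ) < 0 somewhere on [0,1) (¬ScatteringLengthSign:
net attraction below the isotropic
point) kills the dictionary as well: close `refuted:ScatteringLengthSign` unless the failure is a
finite-size artefact at small L₀ (then
`--restate` with a larger threshold is NOT allowed to paper over it — re-derive a(Δ) first).
AnisotropyMonotone refuted by a certified
small-torus computation ⇒ `--drop AnisotropyMonotone` (not load-bearing; the card's comparison line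
dies, the route continues on X_IR).
SchemeTransfer can only be refuted together with PeriodicBEC (its consequent) — that refutes the
conjunct's torus form and every sibling
lattice route at once. PeriodicBEC or the conjunct proved elsewhere moots
SchemeTransfer/BoundaryTransferWeak but not the lattice items;
BoundaryTransferWeak refuted (shared, 40+ routes) forces the common pivot to a Dirichlet-native
tail.

NOT DECOMPOSED YET. The constants (ε, ν₀, the factor 2, c = 4πa(Δ) and its first-order value
6(1−Δ)); the all-fillings and all-d ≥ 3 strengthening of the
rank-2 crux (the retired route's form — kept in reserve; the dilute corner is the conjunct's twin
and the refuters' "best-posed" instance);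
the half-filling lattice headline EasyPlaneIntervalLRO ⇐ AnisotropyMonotone + SectorMixtureBound
(stmt-AtomisticToContinuum-5009) + KLS,
which is a lattice-only thesis with no continuum second anchor and therefore not an item of a summit
route (filed as a Literature-side
target if AnisotropyMonotone survives ED); every layer-2 child of SchemeTransfer (waits for a proof
of the rank-2 crux); positive
temperature; spins S ≥ 1; the easy-axis side Δ > 1 (Kennedy 1985 contours, KomaNachtergaele1997 kink
states) — not claimed.

CHEAPEST FALSIFIER. Sector-resolved exact diagonalisation of H_Δ on Δ ∈ {0, 0.1, …, 0.9, 0.95, 1}: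
rings L = 6…12 (d = 1), 4×4 (N ≤ 8) and 6×6 (N ≤ 5) (d = 2),
2×2×2 (N ≤ 4), 3×3×3 (N ≤ 6), 4×4×4 (N ≤ 4) (d = 3), tabulating B_L(N,Δ) = ‖S⁻_tot ψ‖²
(AnisotropyMonotone: non-decreasing in Δ in the
d = 3 sectors; AnchorExact: = N(L^d − N + 1) at Δ = 1; NearIsotropicDiluteBEC sanity: ratio ≥ ½),
and the two-body shift
L³(E_L(2) − 2E_L(1) + E_L(0)) on (ℤ/Lℤ)³, L = 4…10, Δ ∈ {0, .25, .5, .75, .9, .95, .99, 1}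
(ScatteringLengthSign: positive, → 4πa(Δ) =
6(1−Δ) + O((1−Δ)²), 0 at Δ = 1). SUBMITTED by this seat as kit job j004044 (kit/xxz_ed.py,
numpy/scipy, 2 cores, 8 GB; queued at filing)
with `--workitem stmt-AtomisticToContinuum-13909`: summary + outputs/xxz_ed.json are ATTACHED AS
EVIDENCE to the AnisotropyMonotone item when it
ends — read that first. One non-monotone d = 3 sector ⇒ `--drop AnisotropyMonotone`; a ratio < ½
near Δ = 1 at these sizes would be a red
flag for the rank-2 crux (not expected: the factor 2 leaves room for O(√Y) depletion only).

NUMBERS. Exact: B_L(N,1) = N(L³ − N + 1) (condensate fraction 1 − ν + 1/L³; Toth1991's upper bound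
λ_max ≤ N(V−N+1)/V saturated only at the SU(2)
point); one magnon: E_L(1) − E_L(0) = 3Δ − 3, dispersion 3Δ − Σᵢcos kᵢ (mass 1, hopping ½); two
adjacent magnons attract by Δ, so
a(Δ) = scattering length (reduced mass ½, −∇²ψ + Uψ = 0) of hard core + nearest-neighbour well Δ:
a(1) = 0 (Dyson1956), first order
a(Δ) = (3/2π)(1−Δ) ≈ 0.477(1−Δ) lattice units (the SU(2) zero-energy pair state is uniform off the
diagonal, so ⟨δU⟩ = 6(1−Δ)/(V−1) and
V·ΔE₂ → 4πa), a(0) = the hard-core simple-cubic value (from the Watson-type integral c₃ ≈ 0.505 of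
LSSY2005 (11.27)); Y(Δ,ν) = ν a(Δ)³ ≈
0.109·ν(1−Δ)³; Bogoliubov depletion ∝ √Y, healing length
∝ (ν(1−Δ))^{−1/2} lattice units; KLS anchor constant at d = 3, Δ = 0, ν = ½: L^{−6}A ≥ ½ −
½(√3·c₃)^{1/2} ≈ 0.032 (LSSY2005 (11.26)–(11.27) at λ = 0, β → ∞, c₃ ≈ 0.505,
held copy p. 123).
Items at open: 8 (3 cruxes, 4 supports, 1 assembly).

DEFINITION REQUESTS. None. The sector ground state is encoded by the penalty over existing
`xxzHamiltonian`, `torusGraph`, `totalSpin`,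
`Matrix.groundStateFunctional`, `Matrix.groundSpace`, `lowestEnergyInSector`; the continuum tail
uses `PeriodicTrialState`, `periodicEnergy`,
`periodicGroundStateEnergy`, `condensateOccupation`, `sideLength`, `IsRepulsiveFiniteRange`,
`HasGroundStateBEC` (all `lean search`ed;
Sketch.lean rc 0, axioms propext/Classical.choice/Quot.sound). Bib entries added by this seat:
CorreggiGiulianiSeiringer2015,
MatsubaraMatsuda1956, KomaNachtergaele1997, HuangYang1957, Wortis1963, Sankovich2018, Heims1964
(commit 834aaf52b588).

Novelty: Searches (2026-08-15, this seat): `lit galaxy search --star all` "easy-plane ferromagnet" (12 rows: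
solitons/LLG/Onufrieva JETP 1989 anharmonic
easy-plane FM — physics, no LRO theorem), "XXZ ferromagnet" (6 rows: KomaNachtergaele1997 =
arXiv:cond-mat/9512120 easy-AXIS gap; quantum
groups), "condensation of magnons" / "Bose-Einstein condensation of magnons" (13/8 rows: magnonics,
Streib–Kopietz hard-core-boson approach to
saturated Cs₂CuCl₄ — physics), "scattering length vanishes" (3, unrelated), "lattice Bose gas" (10,
unrelated), "hard-core bosons" --star pdf
(8, DMRG/physics); `lit papers --grep Bose` (held: Sankovich2018 = doi:10.1088/2399-6528/aae551,
READ pp. 1, 3, 6, 9: claims zero-mode BEC for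
WEAKLY interacting soft-core lattice bosons at small μ via an infrared bound for a Bogoliubov inner
product without RP — an unrefereed-grade
claim not used by LSSY/BFKT and not relied on here; it does not touch hard cores, the XXZ family or
the SU(2) endpoint); `lit cite` of the
seven DOIs above (Crossref metadata confirmed); `lit search` / `lit vsearch` / `lit frontier` were
DOWN at filing (searchd rc 75 ×4, graph
socket reset) — refuter please re-run "easy-plane XXZ ferromagnet ground state long-range order
three dimensions", "nearly saturated
ferromagnet dilute magnon gas condensation rigorous", "lattice Bose gas scattering length zero
crossing condensation" on arXiv/OpenAlex/zbMATH.
Inherited (card + retired route, ids kept): BenassiLeesUeltschi2016 = arXiv:1510.03215 (zero-f  [refs: 10.1088/2399-6528/aae551, 10.1007/bf00704585, 10.1007/bf01017870, 10.1143/jpsj.58.1027, 10.1016/j.physleta.2007.06.065, 10.1007/s00220-015-2402-0, cond-mat/9512120, 1510.03215, doi:10.1088/2399-6528/aae551, doi:10.1007/bf00704585, doi:10.1007/bf01017870, doi:10.1143/jpsj.58.1027, doi:10.1016/j.physleta.2007.06.065, doi:10.1007/s00220-015-2402-0, KomaNachtergaele1997, Sankovich2018, BenassiLeesUelt]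

Barriers (technique_class: anchor-deformation, infrared-RG, lattice-bridge): - technique_class: anchor-deformation, infrared-RG, lattice-bridge
- Literature.Barriers.AtomisticToContinuum.BogoliubovPerturbationInfrared: APPLIES SQUARELY to
NearIsotropicDiluteBEC and, through it, to SchemeTransfer (said in their why-lines): d = 3, T = 0,
quadratic dispersion, Σ_k k⁻⁴; it does not evade it — the bet is that the bounded diagonal
deformation of an exact gapless multiplet with explicit magnon eigenbasis, lattice UV and TWO small
parameters (1−Δ and ν) is where the Ward-identity / Feshbach–Schur resummation is completed first;
the narrowed entry BogoliubovPerturbationInfraredNarrow records that derivative (Ward) vertices are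
finite in d = 3 and that the open point is the large-field problem, whose unbounded-field form is
absent for hard-core bosons (occupation 0/1, bounded diagonal V) — whether a bounded analogue
survives is exactly what the rank-2 crux tests.
- Literature.Barriers.AtomisticToContinuum.HalfFillingReflectionPositivity: not invoked anywhere on
(0,1] (ferromagnetic z-coupling: wrong sign parity, Speer1985); KLS enters only the idle comparison
support AnisotropyMonotone as the Δ = 0 endpoint; the rank-2 crux is an expansion from the SU(2) end
and uses no reflection.
- Literature.Barriers.AtomisticToContinuum.HalfFillingReflectionPositivityNarrow: its proved
conjunct rp_oddCharge_eq_zero (RP state ⇒ ⟨N⟩ = |Λ|/2) is respected — the dilute corner is reached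
through sectors (Perron–Frobenius + penalty), never through an RP state.
- Literature.Barrie

History (route lifecycle, newest last):
- 2026-08-17T11:26:56Z · rev 4: restated Assembly (stmt-AtomisticToContinuum-13911) — ground repair (ground-failed: Assembly stmt-AtomisticToContinuum-13911 ground.trivial by `tauto`): restate the Assembly item as the frame statement X → Statemen (planner-rground-AtomisticToContinuum-BECZeroCro-df709fe9-0)
- 2026-08-25T02:45:40Z · DORMANT — reconciler: no traction for 7.3 d (last activity item-evidence-added at 2026-08-17T18:55:01Z); parked, not closed — `ledger route dormant route-AtomisticToConti (operator:999:4006386)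
- 2026-08-29T03:31:38Z · REACTIVATED — reconciler: reactivated — activity statement-checked at 2026-08-29T01:17:37Z after parking at 2026-08-25T02:45:40Z (operator:999:466906)
- 2026-08-29T19:27:06Z · DORMANT — census g0: costume|duplicate of —; reader census-reader-34-g0 (operator:999:887919)

sub-problem: BoseEinsteinCondensation · status: dormant · opened planner-plancard-AtomisticToContinuum-BoseEin-dc2491fc-g2-0 2026-08-15T19:04:08Z · rev 4 · ledger route-AtomisticToContinuum-BECZeroCrossingDilute
GENERATED by the gate from the ledger (D-0016/17). Provers cite these decls: `theorem foo : Summit.AtomisticToContinuum.BoseEinsteinCondensation.Theses.BECZeroCrossingDilute.<Decl> := …` in Summits/AtomisticToContinuum/BoseEinsteinCondensation/Theorems/<Name>.lean.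
-/

namespace Summit.AtomisticToContinuum.BoseEinsteinCondensation.Theses.BECZeroCrossingDilute

open scoped BigOperators Topology Manifold Classical MeasureTheory ProbabilityTheory Matrix InnerProductSpace ComplexConjugate ContinuousMap
open Filter Set Function TopologicalSpace MeasureTheory

attribute [summit_statement] _root_.BoseEinsteinCondensation

/-- item stmt-AtomisticToContinuum-13905 · crux · rank 2 · open · by planner
why it might fail: It IS the marginal d=3, T=0 infrared problem (BogoliubovPerturbationInfrared): naive second order in (1−Δ) gives a depletion Σ_k k⁻⁴ ∼ L before resummation; no continuous-symmetry-broken Bose ground state has been constructed uniformly in volume (Benfatto: n! bounds; BFKT incomplete).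
sources: Benfatto1994, BFKT2017, BalabanEtAl2010, CorreggiGiulianiSeiringer2015, Dyson1956, Tasaki2020
[crux] (card G3, dilute corner, d = 3) there are ε > 0 and ν₀ > 0 such that for every L ≥ 2, every
particle number N ≤ ν₀L³ and every anisotropy Δ ∈ [1 − ε, 1], the sector ground state of the
easy-plane XXZ ferromagnet on (ℤ/Lℤ)³ keeps at least half of the exact SU(2) condensate: N(L³ − N +
1) ≤ 2·B_L(N,Δ), B_L(N,Δ) = Re ω_pen(S¹_tot² + S²_tot²) + N − L³/2 = ⟨S⁺_tot S⁻_tot⟩ = L³·λ_max(γ_N)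
(ω_pen = ground-state functional of H_Δ + 4L³(S³_tot + (L³/2 − N))²). Uniform in L; contains the
thermodynamic dilute limit ν → 0 at fixed Δ = 1 − ε (lattice twin of the conjunct) and the
zero-crossing limit Δ → 1 at fixed ν ≤ ν₀. [difficulty: open-problem] -/
@[route_item "route-AtomisticToContinuum-BECZeroCrossingDilute", crux]
def NearIsotropicDiluteBEC : Prop :=
  ∃ ε ν₀ : ℝ, 0 < ε ∧ 0 < ν₀ ∧ ∀ (L : ℕ) [NeZero L], 2 ≤ L → ∀ N : ℕ, (N : ℝ) ≤ ν₀ * (L : ℝ) ^ 3 → ∀ Δ : ℝ, 1 - ε ≤ Δ → Δ ≤ 1 → (N : ℝ) * ((L : ℝ) ^ 3 - N + 1) ≤ 2 * (((Literature.MathematicalPhysics.QuantumLattice.xxzHamiltonian 1 (Literature.Probability.LatticeModels.torusGraph 3 L) (-1) Δ + (((3 + 1) * L ^ 3 : ℕ) : ℂ) • (Literature.MathematicalPhysics.QuantumLattice.totalSpin 1 2 + ((L : ℂ) ^ 3 / 2 - (N : ℂ)) • 1) ^ 2).groundStateFunctional (Literature.MathematicalPhysics.QuantumLattice.totalSpin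 1 0 * Literature.MathematicalPhysics.QuantumLattice.totalSpin 1 0 + Literature.MathematicalPhysics.QuantumLattice.totalSpin 1 1 * Literature.MathematicalPhysics.QuantumLattice.totalSpin 1 1)).re + N - (L : ℝ) ^ 3 / 2)

/-- item stmt-AtomisticToContinuum-13906 · crux · rank 3 · open · by planner
why it might fail: Bare implication, no easier than PeriodicBEC unless the antecedent is proved by a transferable scheme: the continuum has no SU(2)-exact endpoint at fixed admissible v (a = 0 only for v = 0), hard cores make the deformation unbounded, and Dyson softening costs kinetic energy.
sources: LSSY2005, Fournais2020, Benfatto1994, MatsubaraMatsuda1956, Literature.Barriers.AtomisticToContinuum.BogoliubovPerturbationInfrared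
[crux] (card G5, the bridge) NearIsotropicDiluteBEC (antecedent verbatim) implies PeriodicBEC: for
every repulsive finite-range radial v there is ρ₀ > 0 such that for 0 < ρ < ρ₀, some c > 0, all
large N and some δ > 0, every δ-near-minimiser of the periodic N-body energy on the torus of side
(N/ρ)^{1/3} has constant-mode occupation ≥ cN (body of stmt-AtomisticToContinuum-0826, verbatim as
consequent). Intended discharge: re-run the scheme that proves the antecedent (bounded deformation
of an exactly condensed gapless point, small parameter Y) with Y = ρa³ after a Dyson-lemma softening
of v; only the SCHEME transfers, not the anchor — no lattice-to-continuum limit theorem is claimed.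
[deps: NearIsotropicDiluteBEC] [difficulty: open-problem] -/
@[route_item "route-AtomisticToContinuum-BECZeroCrossingDilute", crux]
def SchemeTransfer : Prop :=
  (∃ ε ν₀ : ℝ, 0 < ε ∧ 0 < ν₀ ∧ ∀ (L : ℕ) [NeZero L], 2 ≤ L → ∀ N : ℕ, (N : ℝ) ≤ ν₀ * (L : ℝ) ^ 3 → ∀ Δ : ℝ, 1 - ε ≤ Δ → Δ ≤ 1 → (N : ℝ) * ((L : ℝ) ^ 3 - N + 1) ≤ 2 * (((Literature.MathematicalPhysics.QuantumLattice.xxzHamiltonian 1 (Literature.Probability.LatticeModels.torusGraph 3 L) (-1) Δ + (((3 + 1) * L ^ 3 : ℕ) : ℂ) • (Literature.MathematicalPhysics.QuantumLattice.totalSpin 1 2 + ((L : ℂ) ^ 3 / 2 - (N : ℂ)) • 1) ^ 2).groundStateFunctional (Literature.MathematicalPhysics.QuantumLattice.totalSpin 1 0 * Literature.MathematicalPhysics.QuantumLattice.totalSpin 1 0 + Literature.MathematicalPhysics.QuantumLattice.totalSpin 1 1 * Literature.MathematicalPhysics.QuantumLattice.totalSpin 1 1)).re + N - (L : ℝ)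 ^ 3 / 2)) → ∀ v : ℝ → ENNReal, Literature.MathematicalPhysics.QuantumManyBody.BoseGas.IsRepulsiveFiniteRange v → ∃ ρ₀ : ℝ, 0 < ρ₀ ∧ ∀ ρ : ℝ, 0 < ρ → ρ < ρ₀ → ∃ c : ℝ, 0 < c ∧ ∀ᶠ N : ℕ in Filter.atTop, ∃ δ : ENNReal, 0 < δ ∧ ∀ Ψ : Literature.MathematicalPhysics.QuantumManyBody.BoseGas.PeriodicTrialState N (Literature.MathematicalPhysics.QuantumManyBody.BoseGas.sideLength ρ N), Literature.MathematicalPhysics.QuantumManyBody.BoseGas.periodicEnergy v Ψ ≤ Literature.MathematicalPhysics.QuantumManyBody.BoseGas.periodicGroundStateEnergy v N (Literature.MathematicalPhysics.QuantumManyBody.BoseGas.sideLength ρ N) + δ → ENNReal.ofReal (c * N) ≤ Literature.MathematicalPhysics.QuantumManyBody.BoseGas.condensateOccupation N (Literature.MathematicalPhysics.QuantumManyBody.BoseGas.sideLength ρ N) Ψ.ψ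

/-- item stmt-AtomisticToContinuum-0827 · crux · rank 4 · open · by planner
why it might fail: PeriodicBEC(v) is ground-state-only at side (N/ρ)^{1/3}: the Dirichlet ground state is a periodic trial state but lies a wall term ≫ δ above E₀^per, and interior restrictions are neither periodic nor of sharp N; no condensate b.c. transfer is in print.
sources: LSSY2005, Junge2026, BoccatoSeiringer2023, LauwersVerbeureZagrebnov2003, Fournais2020
[crux] BoundaryTransferWeak (mode-free boundary-condition transfer, per potential): for each
repulsive finite-range v, PeriodicBEC(v) implies ∃ρ₀>0 ∀ρ∈(0,ρ₀) HasGroundStateBEC v ρ (Dirichlet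
ground state, λ_max(γ) ≥ cN via condensateNumber). Not glue: near-minimiser slacks are O(N/L²) while
Dirichlet/periodic energies differ by a boundary term ≫ N/L², so no energy-comparison proof;
expected route: Neumann bracketing of interior sub-boxes (−Δ_Dir ≥ ⊕−Δ_Neu, v ≥ 0) + a mode-free
criterion (λ_max ≥ tr γ²/N). Only the ENERGY analogue is in print (LiebSeiringerSolovejYngvason2005
Ch. 2 after (2.8)). v ≡ 0: hypothesis and conclusion both true. -/
@[route_item "route-AtomisticToContinuum-BECZeroCrossingDilute", crux]
def BoundaryTransferWeak : Prop :=
  ∀ v : ℝ → ENNReal, Literature.MathematicalPhysics.QuantumManyBody.BoseGas.IsRepulsiveFiniteRange v → (∃ ρ₀ : ℝ, 0 < ρ₀ ∧ ∀ ρ : ℝ, 0 < ρ → ρ < ρ₀ → ∃ c : ℝ, 0 < c ∧ ∀ᶠ N : ℕ in Filter.atTop, ∃ δ : ENNReal, 0 < δ ∧ ∀ Ψ : Literature.MathematicalPhysics.QuantumManyBody.BoseGas.PeriodicTrialState N (Literature.MathematicalPhysics.QuantumManyBody.BoseGas.sideLength ρ N), Literature.MathematicalPhysics.QuantumManyBody.BoseGas.periodicEnergy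 v Ψ ≤ Literature.MathematicalPhysics.QuantumManyBody.BoseGas.periodicGroundStateEnergy v N (Literature.MathematicalPhysics.QuantumManyBody.BoseGas.sideLength ρ N) + δ → ENNReal.ofReal (c * N) ≤ Literature.MathematicalPhysics.QuantumManyBody.BoseGas.condensateOccupation N (Literature.MathematicalPhysics.QuantumManyBody.BoseGas.sideLength ρ N) Ψ.ψ) → ∃ ρ₀ : ℝ, 0 < ρ₀ ∧ ∀ ρ : ℝ, 0 < ρ → ρ < ρ₀ → Literature.MathematicalPhysics.QuantumManyBody.BoseGas.HasGroundStateBEC v ρ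

/-- item stmt-AtomisticToContinuum-13907 · support · rank 9 · closed · proved by Summit.AtomisticToContinuum.BoseEinsteinCondensation.Theorems.AnchorExact_proof @ 59aa33217f95 (prover) · by planner
sources: Tasaki2020, Toth1991, Heims1964
[support] (card G1(i), the SU(2) end; provable now) for L ≥ 2 and every N ≤ L³: B_L(N,1) = N(L³ − N
+ 1). Proof: H_1 + |E|/4 = ½Σ_⟨xy⟩(1 − T_xy) (T = transposition) on the connected torus graph, so
the sector ground space of the penalised Hamiltonian is the one symmetric vector |S = L³/2, M = N −
L³/2⟩, and ⟨S¹_tot² + S²_tot²⟩ + M = S(S+1) − M² + M = N(L³ − N + 1). [difficulty: provable-now] -/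
@[route_item "route-AtomisticToContinuum-BECZeroCrossingDilute"]
def AnchorExact : Prop :=
  ∀ (L : ℕ) [NeZero L], 2 ≤ L → ∀ N : ℕ, N ≤ L ^ 3 → ((Literature.MathematicalPhysics.QuantumLattice.xxzHamiltonian 1 (Literature.Probability.LatticeModels.torusGraph 3 L) (-1) 1 + (((3 + 1) * L ^ 3 : ℕ) : ℂ) • (Literature.MathematicalPhysics.QuantumLattice.totalSpin 1 2 + ((L : ℂ) ^ 3 / 2 - (N : ℂ)) • 1) ^ 2).groundStateFunctional (Literature.MathematicalPhysics.QuantumLattice.totalSpin 1 0 * Literature.MathematicalPhysics.QuantumLattice.totalSpin 1 0 + Literature.MathematicalPhysics.QuantumLattice.totalSpin 1 1 * Literature.MathematicalPhysics.QuantumLattice.totalSpin 1 1)).re + N - (L : ℝ) ^ 3 / 2 = (N : ℝ) * ((L : ℝ) ^ 3 - N + 1)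

-- `AnchorExact` holds: proved by `Summit.AtomisticToContinuum.BoseEinsteinCondensation.Theorems.AnchorExact_proof` @ 59aa33217f95 (its module imports this route file, so no `_holds` link can be stated here).

/-- item stmt-AtomisticToContinuum-13908 · support · rank 9 · closed · proved by Summit.AtomisticToContinuum.BoseEinsteinCondensation.Theorems.PenaltySelectsSectorXXZ_proof @ 59aa33217f95 (prover) · by planner
sources: Tasaki2020, KLS1988PRL
[support] (encoding lemma; XXZ version of stmt-AtomisticToContinuum-5011; provable now) for L ≥ 1, N
≤ L³ and 0 ≤ Δ ≤ 1 every ground vector of H_Δ + 4L³·(S³_tot + (L³/2 − N)·1)² lies in the sector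
S³_tot = N − L³/2: H_Δ commutes with S³_tot, each bond −(S¹S¹ + S²S² + ΔS³S³) has spectral width
exactly 1 for |Δ| ≤ 1, so the width of H_Δ is ≤ |E| ≤ 3L³ < 4L³ ≤ the penalty of any other sector,
and the target sector is non-empty. [difficulty: provable-now] -/
@[route_item "route-AtomisticToContinuum-BECZeroCrossingDilute"]
def PenaltySelectsSectorXXZ : Prop :=
  ∀ (L : ℕ) [NeZero L] (N : ℕ), N ≤ L ^ 3 → ∀ Δ : ℝ, 0 ≤ Δ → Δ ≤ 1 → ∀ ψ : Literature.MathematicalPhysics.QuantumLattice.TensorIndex (Literature.Probability.LatticeModels.TorusSite 3 L) 2 → ℂ, ψ ∈ (Literature.MathematicalPhysics.QuantumLattice.xxzHamiltonian 1 (Literature.Probability.LatticeModels.torusGraph 3 L) (-1) Δ + (((3 + 1) * L ^ 3 : ℕ) : ℂ) • (Literature.MathematicalPhysics.QuantumLattice.totalSpin 1 2 + ((L : ℂ) ^ 3 / 2 - (N : ℂ)) • 1) ^ 2).groundSpace → (Literature.MathematicalPhysics.QuantumLattice.totalSpin (Λ := Literature.Probability.LatticeModels.TorusSite 3 L) 1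 2 + ((L : ℂ) ^ 3 / 2 - (N : ℂ)) • 1).mulVec ψ = 0

-- `PenaltySelectsSectorXXZ` holds: proved by `Summit.AtomisticToContinuum.BoseEinsteinCondensation.Theorems.PenaltySelectsSectorXXZ_proof` @ 59aa33217f95 (its module imports this route file, so no `_holds` link can be stated here).

/-- item stmt-AtomisticToContinuum-13909 · support · rank 9 · open · by planner
sources: BenassiLeesUeltschi2016, KLS1988PRL, Toth1991, Tasaki2020
[support] (card G2 in the repaired, SUMMED form; d = 3; the comparison line between the two anchored
endpoints, NOT an antecedent of `closes`) for L ≥ 2, every sector N ≤ L³ and 0 ≤ Δ ≤ Δ' ≤ 1: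
A_L(N,Δ) ≤ A_L(N,Δ'), A_L(N,Δ) = Re ω_pen(S¹_tot² + S²_tot²) — raising the ferromagnetic z-coupling
(lowering the magnon scattering length) never lowers the planar moment of the sector ground state;
automatic at Δ' = 1 (A_L(N,1) is the maximum of S¹_tot²+S²_tot² on the sector). With KLS (tree
theorem kennedy_lieb_shastry_xy_ground_holds) and a sector-mixture lemma it would give planar LRO at
half filling for every Δ ∈ [0,1]; here it is the cheapest decisive test of the dictionary. Filed as
support so that its refutation is a `--drop`, never a broken assembly. [difficulty: L] -/
@[route_item "route-AtomisticToContinuum-BECZeroCrossingDilute"]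
def AnisotropyMonotone : Prop :=
  ∀ (L : ℕ) [NeZero L], 2 ≤ L → ∀ N : ℕ, N ≤ L ^ 3 → let A : ℝ → ℝ := (fun t => ((Literature.MathematicalPhysics.QuantumLattice.xxzHamiltonian 1 (Literature.Probability.LatticeModels.torusGraph 3 L) (-1) t + (((3 + 1) * L ^ 3 : ℕ) : ℂ) • (Literature.MathematicalPhysics.QuantumLattice.totalSpin 1 2 + ((L : ℂ) ^ 3 / 2 - (N : ℂ)) • 1) ^ 2).groundStateFunctional (Literature.MathematicalPhysics.QuantumLattice.totalSpin 1 0 * Literature.MathematicalPhysics.QuantumLattice.totalSpin 1 0 + Literature.MathematicalPhysics.QuantumLattice.totalSpin 1 1 * Literature.MathematicalPhysics.QuantumLattice.totalSpin 1 1)).re); ∀ Δ Δ' : ℝ, 0 ≤ Δ → Δ ≤ Δ' → Δ' ≤ 1 → A Δ ≤ A Δ'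

/-- item stmt-AtomisticToContinuum-13910 · support · rank 9 · open · by planner
sources: Dyson1956, Wortis1963, HuangYang1957, Luscher1986, LSSY2005
[support] (card G1(ii), the sign the dictionary rests on; d = 3) for every Δ ∈ [0,1) the two-magnon
finite-volume energy shift is eventually bounded below at the scattering-length scale: ∃ c > 0 ∃ L₀
∀ L ≥ L₀, L³·(E_L(2) − 2E_L(1) + E_L(0)) ≥ c, E_L(k) = lowest energy of H_Δ on (ℤ/Lℤ)³ in the sector
S³_tot = k − L³/2 (Huang–Yang/Lüscher: the limit is 4π·a(Δ) for magnon mass 1, ħ = 1, with a(Δ) the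
s-wave scattering length of hard core + nearest-neighbour well Δ, positive below the bound-state
threshold, and a(Δ) = (3/2π)(1−Δ) + O((1−Δ)²) because the SU(2) zero-energy pair state is uniform
off the diagonal; at Δ = 1 the shift vanishes identically). [difficulty: M] -/
@[route_item "route-AtomisticToContinuum-BECZeroCrossingDilute"]
def ScatteringLengthSign : Prop :=
  ∀ Δ : ℝ, 0 ≤ Δ → Δ < 1 → ∃ c : ℝ, 0 < c ∧ ∃ L₀ : ℕ, ∀ (L : ℕ) [NeZero L], L₀ ≤ L → let E : ℕ → ℝ := (fun k => Literature.MathematicalPhysics.QuantumLattice.lowestEnergyInSector 1 (Literature.MathematicalPhysics.QuantumLattice.xxzHamiltonian 1 (Literature.Probability.LatticeModels.torusGraph 3 L) (-1) Δ) ((k : ℝ) - (L : ℝ) ^ 3 / 2)); c ≤ (L : ℝ) ^ 3 * (E 2 - 2 * E 1 + E 0)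

-- earlier Assembly (stmt-AtomisticToContinuum-13911, replaced 2026-08-17T11:26:56Z -> stmt-AtomisticToContinuum-18092): retired by None — NearIsotropicDiluteBEC → SchemeTransfer → BoundaryTransferWeak → _root_.BoseEinsteinCondensation
/-- item stmt-AtomisticToContinuum-18092 · assembly · rank 1 · open · by planner
sources: LSSY2005, KLS1988PRL, Dyson1956
[assembly] frame statement X → Statement with X = NearIsotropicDiluteBEC (the lattice thesis =
rank-2 crux): the volume-uniform dilute-corner condensate bound 2·B_L(N,Δ) ≥ N(L³−N+1) for the
nearly isotropic easy-plane XXZ ferromagnet on (ℤ/Lℤ)³ implies the conjunct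
BoseEinsteinCondensation. NOT logic — it is the whole lattice-to-continuum transfer of this line,
carried in the route by the two bridge cruxes: Assembly = fun hN v hv => hB v hv (hT hN v hv) from
hT : SchemeTransfer (#3, X → PeriodicBEC) and hB : BoundaryTransferWeak (#4, shared
stmt-AtomisticToContinuum-0827, PeriodicBEC(v) → Dirichlet ground-state BEC at small ρ), checked
sorry-free in the planner's Sketch (Assembly_of : SchemeTransfer → BoundaryTransferWeak → Assembly);
the deciding theorem factors as closes hN hT hB = Assembly_of hT hB hN and is unchanged. Restated
2026-08-17 (ground repair) from the curried form NearIsotropicDiluteBEC → SchemeTransfer →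
BoundaryTransferWeak → BoseEinsteinCondensation, which coincides with `closes` and is closed by
`tauto` (ground.trivial). [difficulty: open-problem as a stand-alone item (it is SchemeTransfer ∧
BoundaryTransferWeak in one line); immediate once #3 and #4 close] [LSSY -/
@[route_item "route-AtomisticToContinuum-BECZeroCrossingDilute"]
def Assembly : Prop :=
  NearIsotropicDiluteBEC → _root_.BoseEinsteinCondensation

/-! D-0027 §2.1 — DECIDING THEOREM (planner-authored via `route open/edit --closes-file`; by planner-plancard-AtomisticToContinuum-BoseEin-dc2491fc-g2-0 2026-08-15T19:04:08Z):
its hypotheses are this route's items and its conclusion the sub-problem Statement (glue_lint), and it elaborates with this file. -/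

@[closes "route-AtomisticToContinuum-BECZeroCrossingDilute"] theorem closes (hN : NearIsotropicDiluteBEC) (hT : SchemeTransfer) (hB : BoundaryTransferWeak) :
    _root_.BoseEinsteinCondensation :=
  fun v hv => hB v hv (hT hN v hv)

end Summit.AtomisticToContinuum.BoseEinsteinCondensation.Theses.BECZeroCrossingDilute
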